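import Summits.CriticalPhenomena.LaceExpansionHighD.MeanFieldD10F3KernelRev2
import Summits.CriticalPhenomena.LaceExpansionHighD.MeanFieldD10Stage1StateRev3
import Literature.Probability.FitznerVanDerHofstad2017.Stage1InstST10D10      -- HOME draft typed/p13/Stage1InstST10D10_DRAFT.lean (module name TBD by the Level-C lead; imports the composite + tails HOME drafts)
import Literature.Probability.FitznerVanDerHofstad2017.MeanFieldD11AppDStage1   -- `NobleAssumption43At.of_dom` (generic `d`; Assumption 4.3 is monotone along `BetaMap.Inputs.Dom` into the well-formed region)
import HarnessLib

/-!
# HOME DRAFT (pub-lace10 typer g8, 2026-08-23; NOT filed — Level C is not staffed, lead RULING D29 (3)) — P1.3 «record shape» / P2.5 pre-positioning: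
# `d = 10`, the LEVEL-C RECORD SHAPE — the two (S2a) binders of the Level-B record RE-BASED on the OUTPUTS of the typed ST10′ Stage-1 recipe
# (`cellST10 E s`), modulo the two field-wise `.Dom` instances against the literal input tables (displayed hypotheses here; P2.3/P2.4's kernel rows at Level C)

WHAT.  Level B (`MeanFieldD10F3KernelRev2`, p331769; referee REF-CHECK-9) is `meanField_full_d10_Rev2L_f3 : hI43(inputsIRev2) → hS43′(inputsORev2) → MeanField 10`,
CONDITIONAL on (S2a) = [NoBLE17] Assumption 4.3 for percolation at the two LITERAL input records.  Level C (coordinator RE-SCOPE 2026-08-22T12:24:50Z) replaces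
the literal records in those two binders by the OUTPUTS of the typed ST10′ Stage-1 recipe — the composite `Stage1Cells.Rem.ST10` with tails, evaluated in
the kernel at the record tuple: `cellST10 E s = Stage1Tails.Rem.ST10.inpMajQ E P40 ρ40 χ40 stateRev3 s S_E S̄_E` (HOME draft `Stage1InstST10D10_DRAFT.lean`;
`E` = the table instance: «R» `CertD10.dataHi` or the (δ) instance «N» `CertD10.EvalRev3P40.dataN`) —
exactly as the `d = 11` line did (`MeanFieldD11AppDStage1` item 2 / `MeanFieldD11AppDStage1Discharged`: `meanField_full_d11_typedStage1_discharged`).  The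
mechanism is the monotonicity of Assumption 4.3 along the information order (`NobleAssumption43At.of_dom`: constants that DOMINATE a well-formed record may
replace it in the hypothesis) applied to the two kernel dominations `(cellST10 E .i).Dom N_I`, `(cellST10 E .o).Dom N_O` (sixty rational `≤`/`≥` rows each,
`decide +kernel` — Level-C tasks P2.3/P2.4; typer g6 census `typed/p13/P13-COMPOSITE.md` §6: 0 wrong-side field under the pre-positioned D55 literals).

THIS MODULE gives (§1) the generic step «Level C from Level B along `Dom`» for ANY conclusion and ANY pair of literal tables, and (§3) its instance
against the LANDED Level-B headline (tables `inputsIRev2` / `inputsORev2`, line Rev2L): the four `d = 10` sentences with their (S2a) binders displayed AT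
THE RECIPE'S OUTPUTS and the two `.Dom` instances displayed as hypotheses —

  `meanField_full_d10_typedStage1_ST10_Rev2L (E) : (cellST10 E .i).Dom inputsIRev2 → (cellST10 E .o).Dom inputsORev2 →
     (Ass. 4.3 at p_I with the constants cellST10 E .i) → (R18-valid → ∀ p ∈ (p_I,p_c), f^{𝒮₇} ≤ Γ → Ass. 4.3 at p with cellST10 E .o) → MeanField 10`.

AT D55 (the coordinator's T-2 ruling; cell recommendation (δ)+C-20+C-21, Rev3 cut pre-positioned `typed/rev3/`, referee REF-CHECK-25): the same four
theorems with `Rev2L_f3 ↦ Rev3.…Rev3_f3`, `inputsIRev2 ↦ inputsIRev3`, `inputsORev2 ↦ inputsORev3`, `inputs?Rev2_WF ↦ inputs?Rev3_WF` (§4, text in a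
comment; zero other edits; DONE as HOME drafts by `typed/p13/gen_dom_st10.py`: `MeanFieldD10Stage1ST10Dom{I,O}Rev3{N,R}_DRAFT.lean` +
`MeanFieldD10Stage1ST10RecordRev3_DRAFT.lean`, both instances), where the two `.Dom` hypotheses are DISCHARGED by kernel rows and disappear from the statement, leaving the honest Level-C label: CONDITIONAL on (S2a′) = Assumption 4.3 AT THE RECIPE'S OUTPUTS (Level U's target, inventory
§3 U-1…U-9) — «unconditional» is claimed nowhere.

§2 ties the one instance literal that `Stage1InstST10D10` could not import to its Summits-side numeral: `((far .i : ℚ) : ℝ) = biRev2 6` (and `far .o` to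
`cWeightsRev2 6`, `Γ₃ = 1`).

HONEST FRAMING.  Term-mode compositions of LANDED theorems + two `norm_num` literal ties; every analytic hypothesis is a displayed binder; no numeral of
record, no literal table, no kernel evaluation of the recipe, no new `def … : Prop`; Level B's label (CONDITIONAL on (S2a)) is unchanged and nothing here is
a claim about percolation beyond the displayed implications.  `[cite:]` tags are LOCATORS (shape of the conclusion / the assumption re-based).
TABLE-INSTANCE CAVEAT: at `E := CertD10.dataHi` («R», seventeen displayed count entries) the (S2a′) binders are honest hypotheses but NOT Level U's target
(the displayed entries carry no tree certificate); the Level-C instance is the (δ) instance «N» (certified NBW majorants, p337944) or whatever T-2 rules.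

[cite: FitznerVanDerHofstad2017, Thm. 1.1 / Cor. 1.3 pp. 5–6 (shape of the conclusion); §§4–6 (the Stage-1 diagrammatic estimates); notebook Percolation.nb cells 1–44]
[cite: FitznerVanDerHofstad2016NoBLE, Assumption 4.3 pp. 1086–1088; Prop. 4.5(ii) p. 1088; Thm. 2.10 / Prop. 2.11 pp. 1060–1061]
-/

set_option Elab.async false

noncomputable section

namespace Summit.CriticalPhenomena.LaceExpansionHighD

namespace D10

open Literature.Barriers.CriticalPhenomena Literature.Probability.Percolation
open Literature.Probability.LatticeModels Literature.Probability.FitznerVanDerHofstad2017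
open Stage1Cells (DataQ)
open Stage1Cells.CertD10.ST10P40 (cellST10 far q3 chi40 SQr SbQr)

/-! ## §1 Level C from Level B along `Dom` — the generic step (any conclusion, any pair of literal tables) -/

/-- **Level C from Level B along `Dom`.**  If a Level-B-shaped implication `levelB` concludes `C` from (S2a) at two WELL-FORMED literal input records
`N_I` (initial point) and `N_O` (window, under `R18`-validity and `f^{𝒮₇} ≤ Γ`), and two records of constants `c_I`, `c_O` DOMINATE them field-wise
(`BetaMap.Inputs.Dom`: every upper-bound field `≤`, the lower-bound fields `≥`), then `C` follows from (S2a) stated at `c_I`, `c_O` — Assumption 4.3 is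
monotone along `Dom` into the well-formed region (`NobleAssumption43At.of_dom`).  This is the form in which the typed Stage-1 recipe's OUTPUTS replace the
literal tables. [cite: FitznerVanDerHofstad2016NoBLE, Assumption 4.3 (4.30)–(4.49) pp. 1086–1088] -/
theorem levelC_of_levelB_of_dom {C : Prop} {NI NO cI cO : BetaMap.Inputs}
    (hWI : NobleInputsWF 10 NI) (hWO : NobleInputsWF 10 NO) (hDI : cI.Dom NI) (hDO : cO.Dom NO)
    (levelB : NobleAssumption43At 10 (nbwThresholdI 10)
        (percolationNobleSplit 10 (nbwThresholdI 10) (by norm_num) (nbwThresholdI_lt_criticalProbI (by norm_num))) NI →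
      ((RemValid 10 18 fun r => ((RemCertD10.R18 r : ℚ) : ℝ)) →
        ∀ (p : unitInterval) (hp : p ∈ Set.Ioo (nbwThresholdI 10) (criticalProbI 10)),
          (∀ j, nobleFOf (nobleTripleSnoc 10 ((1 : ℕ), (17 : ℕ), ({0} : Set (Site 10)))) cMuRev2 cWeightsRev2 j p ≤ GammaRev2 j) →
            NobleAssumption43At 10 p (percolationNobleSplit 10 p (by norm_num) hp.2) NO) → C)
    (hI43 : NobleAssumption43At 10 (nbwThresholdI 10)
      (percolationNobleSplit 10 (nbwThresholdI 10) (by norm_num) (nbwThresholdI_lt_criticalProbI (by norm_num))) cI)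
    (hS43 : (RemValid 10 18 fun r => ((RemCertD10.R18 r : ℚ) : ℝ)) →
      ∀ (p : unitInterval) (hp : p ∈ Set.Ioo (nbwThresholdI 10) (criticalProbI 10)),
        (∀ j, nobleFOf (nobleTripleSnoc 10 ((1 : ℕ), (17 : ℕ), ({0} : Set (Site 10)))) cMuRev2 cWeightsRev2 j p ≤ GammaRev2 j) →
          NobleAssumption43At 10 p (percolationNobleSplit 10 p (by norm_num) hp.2) cO) :
    C :=
  levelB (hI43.of_dom hDI hWI.1) fun hR p hp hΓ => (hS43 hR p hp hΓ).of_dom hDO hWO.1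

/-! ## §2 The instance literals of `Stage1InstST10D10` are the record's numerals -/

/-- `far i` (the rational `823379955188092447 / 10²¹` of the Literature-side instance) IS the record's initial-point literal `biRev2 6 = boundF3Init[1,17]`.
[cite: FitznerVanDerHofstad2017, §2.5 and Figure 3 (the tables b_{n,l})] -/
theorem far_i_cast : ((far .i : ℚ) : ℝ) = biRev2 6 := by
  simp [far, biRev2]; norm_num

/-- `far o = c₇ · Γ₃` IS the record's seventh family weight `cWeightsRev2 6` (`Γ₃ = 1`). [cite: FitznerVanDerHofstad2017, (2.21)–(2.23) and Figure 3] -/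
theorem far_o_cast : ((far .o : ℚ) : ℝ) = cWeightsRev2 6 := by
  rw [Stage1Cells.CertD10.ST10P40.far_o]; exact cWeightsRev3Q_cast 6

/-! ## §3 The `d = 10` sentences with (S2a) AT THE TYPED ST10′ RECIPE'S OUTPUTS, against the LANDED Level-B line Rev2L (the two `.Dom` instances displayed) -/

/-- **`d = 10`, Level-C SHAPE on line Rev2L**: the triangle condition, `θ(p_c) = 0` and `β = 1` (bounded-ratio sense) on `ℤ¹⁰` from (S2a′) — [NoBLE17]
Assumption 4.3 for percolation with the constants COMPUTED by the typed ST10′ Stage-1 recipe with tails over the table instance `E` (`cellST10 E .i` at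
`p_I`; `cellST10 E .o` at every `p ∈ (p_I, p_c)` with `f^{𝒮₇}(p) ≤ Γ`, `R18` kernel-valid) — GIVEN the two field-wise dominations of those outputs by the
literal records `inputsIRev2` / `inputsORev2` (Level C's kernel rows; hypotheses here).  Level B's `meanField_d10_Rev2L_f3` transported along `Dom`.
[cite: FitznerVanDerHofstad2016NoBLE, Thm. 2.10, Prop. 2.11, Prop. 4.5(ii); Assumption 4.3 pp. 1086–1088] [cite: FitznerVanDerHofstad2017, Thm. 1.1, Cor. 1.3; §§4–6] -/
theorem meanField_d10_typedStage1_ST10_Rev2L (E : DataQ)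
    (hDI : (cellST10 E .i).Dom inputsIRev2) (hDO : (cellST10 E .o).Dom inputsORev2)
    (hI43 : NobleAssumption43At 10 (nbwThresholdI 10)
      (percolationNobleSplit 10 (nbwThresholdI 10) (by norm_num) (nbwThresholdI_lt_criticalProbI (by norm_num))) (cellST10 E .i))
    (hS43 : (RemValid 10 18 fun r => ((RemCertD10.R18 r : ℚ) : ℝ)) →
      ∀ (p : unitInterval) (hp : p ∈ Set.Ioo (nbwThresholdI 10) (criticalProbI 10)),
        (∀ j, nobleFOf (nobleTripleSnoc 10 ((1 : ℕ), (17 : ℕ), ({0} : Set (Site 10)))) cMuRev2 cWeightsRev2 j p ≤ GammaRev2 j) →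
          NobleAssumption43At 10 p (percolationNobleSplit 10 p (by norm_num) hp.2) (cellST10 E .o)) :
    TriangleCondition 10 ∧ PercolationContinuity 10 ∧ BetaEqOneBoundedRatio 10 :=
  levelC_of_levelB_of_dom inputsIRev2_WF inputsORev2_WF hDI hDO meanField_d10_Rev2L_f3 hI43 hS43

/-- **`d = 10`, Level-C SHAPE on line Rev2L: `MeanField 10`** (θ(p_c) = 0, γ = β = 1, δ = 2 in bounded-ratio form) from (S2a′) at the typed ST10′ recipe's
outputs, given the two `.Dom` instances. [cite: FitznerVanDerHofstad2017, Thm. 1.1 and Cor. 1.3 pp. 5–6 (shape of the conclusion)] -/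
theorem meanField_full_d10_typedStage1_ST10_Rev2L (E : DataQ)
    (hDI : (cellST10 E .i).Dom inputsIRev2) (hDO : (cellST10 E .o).Dom inputsORev2)
    (hI43 : NobleAssumption43At 10 (nbwThresholdI 10)
      (percolationNobleSplit 10 (nbwThresholdI 10) (by norm_num) (nbwThresholdI_lt_criticalProbI (by norm_num))) (cellST10 E .i))
    (hS43 : (RemValid 10 18 fun r => ((RemCertD10.R18 r : ℚ) : ℝ)) →
      ∀ (p : unitInterval) (hp : p ∈ Set.Ioo (nbwThresholdI 10) (criticalProbI 10)),
        (∀ j, nobleFOf (nobleTripleSnoc 10 ((1 : ℕ), (17 : ℕ), ({0} : Set (Site 10)))) cMuRev2 cWeightsRev2 j p ≤ GammaRev2 j) →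
          NobleAssumption43At 10 p (percolationNobleSplit 10 p (by norm_num) hp.2) (cellST10 E .o)) :
    MeanField 10 :=
  levelC_of_levelB_of_dom inputsIRev2_WF inputsORev2_WF hDI hDO meanField_full_d10_Rev2L_f3 hI43 hS43

/-- **`d = 10`, Level-C SHAPE on line Rev2L: the NoBLE infrared bound `NobleBootstrapBound 10`** from (S2a′) at the typed ST10′ recipe's outputs, given the
two `.Dom` instances. [cite: FitznerVanDerHofstad2016NoBLE, Thm. 2.10 (2.17) p. 1060 and Prop. 4.5(ii) p. 1088] -/
theorem nobleBootstrapBound_d10_typedStage1_ST10_Rev2L (E : DataQ)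
    (hDI : (cellST10 E .i).Dom inputsIRev2) (hDO : (cellST10 E .o).Dom inputsORev2)
    (hI43 : NobleAssumption43At 10 (nbwThresholdI 10)
      (percolationNobleSplit 10 (nbwThresholdI 10) (by norm_num) (nbwThresholdI_lt_criticalProbI (by norm_num))) (cellST10 E .i))
    (hS43 : (RemValid 10 18 fun r => ((RemCertD10.R18 r : ℚ) : ℝ)) →
      ∀ (p : unitInterval) (hp : p ∈ Set.Ioo (nbwThresholdI 10) (criticalProbI 10)),
        (∀ j, nobleFOf (nobleTripleSnoc 10 ((1 : ℕ), (17 : ℕ), ({0} : Set (Site 10)))) cMuRev2 cWeightsRev2 j p ≤ GammaRev2 j) →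
          NobleAssumption43At 10 p (percolationNobleSplit 10 p (by norm_num) hp.2) (cellST10 E .o)) :
    NobleBootstrapBound 10 :=
  levelC_of_levelB_of_dom inputsIRev2_WF inputsORev2_WF hDI hDO nobleBootstrapBound_d10_Rev2L_f3 hI43 hS43

/-- The ladder step, Level-C SHAPE on line Rev2L: with (S2a′) at the typed ST10′ recipe's outputs and the two `.Dom` instances, «∀ d ≥ 11, TriangleCondition d»
upgrades to «∀ d ≥ 10, TriangleCondition d». [cite: FitznerVanDerHofstad2017, Thm. 1.1 and Cor. 1.3 pp. 5–6 (shape of the conclusion)] -/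
theorem triangleConditionFrom_d10_typedStage1_ST10_Rev2L (E : DataQ)
    (hDI : (cellST10 E .i).Dom inputsIRev2) (hDO : (cellST10 E .o).Dom inputsORev2)
    (hI43 : NobleAssumption43At 10 (nbwThresholdI 10)
      (percolationNobleSplit 10 (nbwThresholdI 10) (by norm_num) (nbwThresholdI_lt_criticalProbI (by norm_num))) (cellST10 E .i))
    (hS43 : (RemValid 10 18 fun r => ((RemCertD10.R18 r : ℚ) : ℝ)) →
      ∀ (p : unitInterval) (hp : p ∈ Set.Ioo (nbwThresholdI 10) (criticalProbI 10)),
        (∀ j, nobleFOf (nobleTripleSnoc 10 ((1 : ℕ), (17 : ℕ), ({0} : Set (Site 10)))) cMuRev2 cWeightsRev2 j p ≤ GammaRev2 j) →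
          NobleAssumption43At 10 p (percolationNobleSplit 10 p (by norm_num) hp.2) (cellST10 E .o))
    (h11 : Summit.CriticalPhenomena.LaceExpansionHighD.TriangleConditionFrom 11) :
    Summit.CriticalPhenomena.LaceExpansionHighD.TriangleConditionFrom 10 :=
  levelC_of_levelB_of_dom inputsIRev2_WF inputsORev2_WF hDI hDO (fun hI hS => triangleConditionFrom_d10_Rev2L_f3 hI hS h11) hI43 hS43

/-! ## §4 (TEXT ONLY — the Level-B line it targets is a HOME draft until the T-2 ruling) the same four sentences on line Rev3 = (δ)+C-20+C-21

At D55 the pre-positioned Rev3 cut (`typed/rev3/MeanFieldD10Rev3Cut_DRAFT.lean` 67a925bd62824d36 → five tree files, REF-CHECK-25) lands the Level-B headline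
`D10.Rev3.meanField_full_d10_Rev3_f3 : hI43(inputsIRev3) → hS43′(inputsORev3) → MeanField 10` with `inputsIRev3_WF` / `inputsORev3_WF`; the Level-C record is
then, verbatim up to these names (and `E :=` the (δ) table instance of P2.1, `hDI`/`hDO` := P2.3/P2.4's kernel theorems instead of binders):

  theorem meanField_full_d10_typedStage1_ST10 (hI43 : … (cellST10 E_N .i)) (hS43 : … (cellST10 E_N .o)) : MeanField 10 :=
    levelC_of_levelB_of_dom inputsIRev3_WF inputsORev3_WF cellST10_dom_i cellST10_dom_o Rev3.meanField_full_d10_Rev3_f3 hI43 hS43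

(and the three companions).  Nothing of this section is a declaration. -/

end D10

end Summit.CriticalPhenomena.LaceExpansionHighD

end
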